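import Summits.CriticalPhenomena.PercolationContinuityZ3.Theorems.Transplant.KNCellsBoxProdZ2ConcReach
import Summits.CriticalPhenomena.PercolationContinuityZ3.Theorems.Transplant.BoxProdZ2ConcExcess
import Summits.CriticalPhenomena.PercolationContinuityZ3.Theorems.Transplant.BoxProdZ2ConcFaceRegion
import Summits.CriticalPhenomena.PercolationContinuityZ3.Theorems.Transplant.KNCells2CorridorSub
import Summits.CriticalPhenomena.PercolationContinuityZ3.Theorems.Transplant.KNCellsBoxProdZ2ConcHout
import Summits.CriticalPhenomena.PercolationContinuityZ3.Theorems.Transplant.BoxProdZ2ProdLevels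
import HarnessLib

/-!
# Design (D), residue (C): the RIM EXCESS of the corridor chain (`hexc` of `reachOblAt_concG`, p2-g2) for the concentric scheme
# `concSchemeG X C w₀ Λ q δc` — from p3-g2's `real_rim_le_of_radius`, GIVEN that every explored vertex adjacent to the fresh corridor
# world is fibre-deep (`hdeep`, radius `R₀`; true along RUNS — `KNCells2RunRestricted` — and discharged there from `RunInv₂.V_cases`)

builds on p205010 (kernel theorem, internal audit signed; external expert review pending) — nothing in this file uses p205010.
Lane `prim-bschramm`, seat `prim-bschramm-p5` (gen 3, refuter; holder of residue (C), lead 15:03:38Z / 15:15:37Z), helper file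
(`--supports stmt-CriticalPhenomena-4575`).

THE POINT (refuter's blocker 15:15Z).  The corridor chain of the probe `(v → x)` runs in the tube `B_X(w₀,E) × ℤ²` over the FRESH world
`W = E_{v,x} ∪ H_{x,y}` minus the explored region; its rim device needs `P_{Wcor}(root ↔ Rim) ≤ η` for rims at fibre radius `> E - L'`.
By p3-g2's collar lemma this holds as soon as every positive-weight ENTRANCE into the fresh world lands at fibre radius `≤ R₀ + 1` with
`R₀ + 1 + (excess radius) ≤ E - L'`.  Entrances are explored vertices `G`-adjacent to the fresh world; `hdeep` says they have fibre
radius `≤ R₀`.  (For an arbitrary `Valid₂` history `hdeep` can fail — cover-junk beside `Btw_α(v,x)` at radius `E` — which is why the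
obligations are now owed at run histories only.)
* `PCells.Q_subset_box_image`, `PCells.Btw_subset_box_image_tgt`, `PCells.Hfull_subset_box_image` — planar boundedness of the world
  (`⊆ cen x + Λ_{25r}`);
* **`real_rim_le_concG`** — `P_{Wcor(h,e,α,a',du)}(⋃_{t ∈ Rim} (w₀,0) ↔ t) ≤ η` for every `Rim ⊆ B(w₀,E) × (Q x ∪ Hfull x du)` beyond fibre
  radius `E - L'`, given the radius facts of the schedule (`rQ α x = E`, `ρ a' x du · = E`, `rB α v δ ≤ E`, `E ≤ rE a' x du`), `hdeep`
  with `R₀ ≤ E`, the excess radius `R₁` at the running parameter (shape of `BoxProdZ2.exists_excess_radius` with `V₀ = {w₀}`,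
  `R₀' = R₀ + 1`, `n = 25 r`) and `R₁ ≤ E - L'`.
[cite: KozmaNitzan2024, §4 Lemma 12 (p. 24), p. 31 (D is a subbox of Ω)]
-/

noncomputable section

open MeasureTheory ProbabilityTheory
open scoped ENNReal Classical

namespace Summit.CriticalPhenomena.PercolationContinuityZ3.Theorems

namespace Transplant

open Literature.Probability.Percolation Literature.Probability.LatticeModels SimpleGraph GadgetSystem ProbeHistory HSiteScheme Contour KNCells
open Literature.Probability.Percolation.KozmaNitzan
open Literature.Probability.Percolation.KozmaNitzan.Cells (oth oth_ne sgOf sgOf_sign stepVec_apply_fst stepVec_apply_oth eq_oth_of_ne oth_oth)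
open Literature.Barriers.CriticalPhenomena (mem_graphBall_self)

/-! ## Planar boundedness of the corridor world -/

namespace PCells

variable (C : PCells)

/-- `Q v ⊆ cen v + Λ_{25 r}`. [folklore] -/
theorem Q_subset_box_image (v : Site 2) : C.Q v ⊆ (box 2 (25 * C.r)).image (fun s => s + C.cen v) := by
  intro t ht
  rw [Q, C.mem_sq_iff] at ht
  refine Finset.mem_image.2 ⟨t - C.cen v, ?_, by abel⟩
  rw [mem_box]
  intro i
  simp only [Pi.sub_apply]
  have h1 := ht i
  push_cast at h1 ⊢
  constructor <;> linarith [h1.1, h1.2, C.one_le_r]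

/-- `Btw v δ ⊆ cen (v + δ) + Λ_{25 r}` (the between-box seen from the target cell). [folklore] -/
theorem Btw_subset_box_image_tgt (v : Site 2) (δ : MDir) :
    C.Btw v δ ⊆ (box 2 (25 * C.r)).image (fun s => s + C.cen (v + stepVec δ)) := by
  intro t ht
  rw [Btw, mem_psBox_iff] at ht
  refine Finset.mem_image.2 ⟨t - C.cen (v + stepVec δ), ?_, by abel⟩
  rw [mem_box]
  intro i
  simp only [Pi.sub_apply]
  push_cast at ht ⊢
  by_cases hi : i = δ.1
  · subst hi
    rw [C.cen_add_stepVec_fst]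
    rcases sgOf_sign δ with hs | hs <;> rw [hs] at ht ⊢ <;> constructor <;> nlinarith [ht.1.1, ht.1.2, C.one_le_r]
  · rw [eq_oth_of_ne hi, C.cen_add_stepVec_oth]; constructor <;> linarith [ht.2.1, ht.2.2, C.one_le_r]

/-- `Hfull v δ ⊆ cen v + Λ_{25 r}`. [folklore] -/
theorem Hfull_subset_box_image (v : Site 2) (δ : MDir) : C.Hfull v δ ⊆ (box 2 (25 * C.r)).image (fun s => s + C.cen v) := by
  intro t ht
  rcases Finset.mem_union.1 (C.Hfull_subset_Q_union_Efar v δ ht) with h | h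
  · exact C.Q_subset_box_image v h
  · exact C.Efar_subset_box_image v δ h

end PCells

/-! ## The rim excess of the corridor chain -/

namespace BoxProdZ2

variable {W : Type} [DecidableEq W] [Countable W] (X : SimpleGraph W) [X.LocallyFinite]

omit [DecidableEq W] [Countable W] in
/-- In `X □ ℤ²`, a neighbour of a vertex with fibre in `B(w₀, R)` has fibre in `B(w₀, R + 1)`. [folklore] -/
private theorem fst_mem_ballFin_succ_of_adj' {w₀ : W} {R : ℕ} {a b : W × Site 2} (hadj : (X □ zdGraph 2).Adj a b)
    (ha : a.1 ∈ ballFin X w₀ R) : b.1 ∈ ballFin X w₀ (R + 1) := by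
  rcases boxProd_adj.1 hadj with ⟨h1, -⟩ | ⟨-, h2⟩
  · exact mem_ballFin_succ_of_adj X ha h1
  · rw [← h2]; exact ballFin_mono X w₀ (Nat.le_succ R) ha

/-- **The rim excess of the corridor world of `concSchemeG` is at most `η`**, given deep entrances (`hdeep`), the radius facts of the
schedule and the excess radius at the running parameter. [cite: KozmaNitzan2024, §4 Lemma 12 (p. 24), p. 31] -/
theorem real_rim_le_concG (C : PCells) (w₀ : W) {Λ : ConcRadiiG} (hΛ : Λ.WF C) {q : unitInterval} {δc : ℝ}
    {h : ProbeHistory (W × Site 2)} {e : Site 2 × MDir} (hV : (concSchemeG X C w₀ Λ q δc).Valid₂ (X □ zdGraph 2) h e)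
    {a' : ℕ} {du : MDir} (hdu : du ∈ (concSchemeG X C w₀ Λ q δc).onward (X □ zdGraph 2) h (tgt e))
    {E : ℕ} (hEQ : Λ.rQ ((concSchemeG X C w₀ Λ q δc).aOf₁ (X □ zdGraph 2) h e) (tgt e) = E) (hρ : ∀ ℓ, Λ.ρ a' (tgt e) du ℓ = E)
    (hB : Λ.rB ((concSchemeG X C w₀ Λ q δc).aOf₁ (X □ zdGraph 2) h e) e.1 e.2 ≤ E) (hEfar : E ≤ Λ.rE a' (tgt e) du)
    {R₀ : ℕ} (hR₀ : R₀ ≤ E)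
    (hdeep : ∀ a ∈ (concSchemeG X C w₀ Λ q δc).Vx (X □ zdGraph 2) h,
      ∀ b ∈ (concSchemeG X C w₀ Λ q δc).Γ.Ewv ((concSchemeG X C w₀ Λ q δc).aOf₁ (X □ zdGraph 2) h e) e.1 e.2 ∪
        (faceDataCG X C w₀ Λ).Hfull a' (tgt e) du,
      b ∉ (concSchemeG X C w₀ Λ q δc).Vx (X □ zdGraph 2) h → (X □ zdGraph 2).Adj a b → a.1 ∈ ballFin X w₀ R₀)
    {L' : ℕ} {η : ℝ} {R₁ : ℕ}
    (hR₁ : ∀ R', R₁ ≤ R' → ∀ τ ∈ ({w₀} : Finset W), ∀ (Rw : ℕ) (D' A' : Finset (W × Site 2)),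
      D' ⊆ ballFin X τ Rw ×ˢ box 2 (25 * C.r) → A' ⊆ D' → (∀ a ∈ A', a.1 ∈ ballFin X τ (R₀ + 1)) →
      (bondPercolation (X □ zdGraph 2) q).real (excess X τ R' D' A') ≤ η)
    (hR : R₁ ≤ E - L') {Rim : Finset (W × Site 2)} (hRim : Rim ⊆ ballFin X w₀ E ×ˢ (C.Q (tgt e) ∪ C.Hfull (tgt e) du))
    (hRimfar : ∀ t ∈ Rim, t.1 ∉ ballFin X w₀ (E - L')) :
    (prodBernoulli ((concSchemeG X C w₀ Λ q δc).Wcor (X □ zdGraph 2) (faceDataCG X C w₀ Λ) h e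
      ((concSchemeG X C w₀ Λ q δc).aOf₁ (X □ zdGraph 2) h e) a' du)).real
      (⋃ t ∈ Rim, openConn ((w₀, (0 : Site 2)) : W × Site 2) t) ≤ η := by
  -- abbreviations
  set S := concSchemeG X C w₀ Λ q δc with hSdef
  set α := S.aOf₁ (X □ zdGraph 2) h e with hαdef
  set G := X □ zdGraph 2 with hGdef
  set FD := faceDataCG X C w₀ Λ with hFDdef
  have hΓ : S.Γ = cellGeomCG X C w₀ Λ := rfl
  have hL := levelGeomCG X C w₀ hΛ
  have hQ := qSepGeomCG X C w₀ Λ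
  set Wld := S.Γ.Ewv α e.1 e.2 ∪ FD.Hfull a' (tgt e) du with hWld
  set D := Wld.filter (fun b => b ∉ S.Vx G h) with hDdef
  -- (f1) fibres of the world lie in the window
  have hWπ : ∀ b ∈ Wld, b.1 ∈ ballFin X w₀ E := by
    intro b hb
    rcases Finset.mem_union.1 hb with hb | hb
    · change b ∈ S.Γ.Btw α e.1 e.2 ∪ S.Γ.Q α (e.1 + stepVec e.2) at hb
      rcases Finset.mem_union.1 hb with hb | hb
      · exact ballFin_mono X w₀ hB (Finset.mem_product.1 hb).1
      · exact ballFin_mono X w₀ (le_of_eq hEQ) (Finset.mem_product.1 hb).1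
    · change b ∈ stair X w₀ (fun t => Λ.ρ a' (tgt e) du (C.lev du (tgt e) t)) (C.Hfull (tgt e) du) at hb
      rw [mem_stair] at hb
      exact ballFin_mono X w₀ (le_of_eq (hρ _)) hb.2
  -- (f2) planar coordinates of the world lie in `cen x + Λ_{25 r}`
  have hWpl : ∀ b ∈ Wld, b.2 ∈ (box 2 (25 * C.r)).image (fun s => s + C.cen (tgt e)) := by
    intro b hb
    rcases Finset.mem_union.1 hb with hb | hb
    · change b ∈ S.Γ.Btw α e.1 e.2 ∪ S.Γ.Q α (e.1 + stepVec e.2) at hb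
      rcases Finset.mem_union.1 hb with hb | hb
      · exact C.Btw_subset_box_image_tgt e.1 e.2 (Finset.mem_product.1 hb).2
      · exact C.Q_subset_box_image _ (Finset.mem_product.1 hb).2
    · change b ∈ stair X w₀ (fun t => Λ.ρ a' (tgt e) du (C.lev du (tgt e) t)) (C.Hfull (tgt e) du) at hb
      rw [mem_stair] at hb
      exact C.Hfull_subset_box_image _ _ hb.1
  -- (f3) the world lies in the habitat-or-between-box: `Wld ⊆ Sx`
  have hWSx : Wld ⊆ S.Sx G h e α a' du := by
    intro b hb
    rcases Finset.mem_union.1 hb with hb | hb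
    · exact Finset.mem_union_left _ (Finset.mem_union_right _ hb)
    · change b ∈ stair X w₀ (fun t => Λ.ρ a' (tgt e) du (C.lev du (tgt e) t)) (C.Hfull (tgt e) du) at hb
      rw [mem_stair] at hb
      obtain ⟨hb2, hb1⟩ := hb
      have hb1' : b.1 ∈ ballFin X w₀ E := ballFin_mono X w₀ (le_of_eq (hρ _)) hb1
      rcases Finset.mem_union.1 (C.Hfull_subset_Q_union_Efar (tgt e) du hb2) with hb3 | hb3
      · refine Finset.mem_union_left _ (Finset.mem_union_right _ (Finset.mem_union_right _ ?_))
        exact Finset.mem_product.2 ⟨ballFin_mono X w₀ (le_of_eq hEQ.symm) hb1', hb3⟩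
      · exact Finset.mem_union_right _ (Finset.mem_product.2 ⟨ballFin_mono X w₀ hEfar hb1', hb3⟩)
  -- (f4) `Wld ⊆ Ucor`
  have hWU : Wld ⊆ S.Ucor G FD h e α a' du := by
    intro b hb
    rcases Finset.mem_union.1 hb with hb | hb
    · exact Finset.mem_union_left _ (Finset.mem_union_right _ hb)
    · exact Finset.mem_union_right _ hb
  have hDW : D ⊆ Wld := Finset.filter_subset _ _
  have hDV : ∀ b ∈ D, b ∉ S.Vx G h := fun b hb => (Finset.mem_filter.1 hb).2
  -- explored vertices of `Ucor` outside `D`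
  have hUout : ∀ x ∈ S.Ucor G FD h e α a' du, x ∉ D → x ∈ S.Vx G h := by
    intro x hx hxD
    by_contra hxV
    rcases Finset.mem_union.1 hx with hx | hx
    · rcases Finset.mem_union.1 hx with hx | hx
      · exact hxV hx
      · exact hxD (Finset.mem_filter.2 ⟨Finset.mem_union_left _ hx, hxV⟩)
    · exact hxD (Finset.mem_filter.2 ⟨Finset.mem_union_right _ hx, hxV⟩)
  -- the subbox property of `Wcor` on `D` in the tube graph
  have hWD : KNLevels.IsSubbox (tubeGraph X (ballFin X w₀ E)) (S.Wcor G FD h e α a' du) q D := by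
    refine KSchA.isSubbox_Wcor_graph (tubeGraph X (ballFin X w₀ E)) (tubeGraph_le X _) hV.F_eq
      (hDW.trans hWSx) (hDW.trans hWU) (Finset.disjoint_left.2 fun b hb hbV => hDV b hb hbV)
      (fun u hu v hv huv => tube_adj_of_fst_mem X huv (hWπ u (hDW hu)) (hWπ v (hDW hv))) ?_
    intro v hv x hx hxD hadj
    have hxV : x ∈ S.Vx G h := hUout x hx hxD
    have hx1 : x.1 ∈ ballFin X w₀ E := ballFin_mono X w₀ hR₀ (hdeep x hxV v (hDW hv) (hDV v hv) hadj)
    exact tube_adj_of_fst_mem X hadj hx1 (hWπ v (hDW hv))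
  -- `Wcor` vanishes off the edges of `X □ ℤ²`
  have hWG : ∀ x, x ∉ G.edgeSet → S.Wcor G FD h e α a' du x = 0 := by
    intro x hx
    by_cases hxU : x ∈ wireSet (↑(S.Ucor G FD h e α a' du) : Set (W × Site 2))
    · by_cases hxS : x ∈ wireSet (↑(S.Sx G h e α a' du) : Set (W × Site 2))
      · have hxF : x ∉ S.F G h := by
          intro hxF
          rw [hV.F_eq, mem_edgesIn_iff] at hxF
          exact hx hxF.1
        rw [KSchA.Wcor_apply_of_mem hxU hxS hxF, KNLevels.lattW_apply, if_neg hx]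
      · show restrW _ (restrW _ _) x = 0
        rw [restrW_apply_of_mem _ hxU, restrW_apply_of_not_mem _ hxS]
    · exact restrW_apply_of_not_mem _ hxU
  -- the root is explored, hence outside `D`
  have hroot : ((w₀, (0 : Site 2)) : W × Site 2) ∉ D := by
    intro hr
    exact hDV _ hr (by have := hV.root_mem; exact this)
  -- the rim lies in `D`: inside the world (radius facts) and fresh (separation of the habitat from the explored region)
  have hRimW : Rim ⊆ Wld := by
    intro t ht
    obtain ⟨ht1, ht2⟩ := Finset.mem_product.1 (hRim ht)
    rcases Finset.mem_union.1 ht2 with ht2 | ht2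
    · refine Finset.mem_union_left _ ?_
      change t ∈ S.Γ.Btw α e.1 e.2 ∪ S.Γ.Q α (e.1 + stepVec e.2)
      exact Finset.mem_union_right _ (Finset.mem_product.2 ⟨ballFin_mono X w₀ (le_of_eq hEQ.symm) ht1, ht2⟩)
    · refine Finset.mem_union_right _ ?_
      change t ∈ stair X w₀ (fun t => Λ.ρ a' (tgt e) du (C.lev du (tgt e) t)) (C.Hfull (tgt e) du)
      rw [mem_stair]
      exact ⟨ht2, ballFin_mono X w₀ (le_of_eq (hρ _).symm) ht1⟩
  have hRimHab : Rim ⊆ S.Γ.Q α (tgt e) ∪ S.Γ.Efar a' (tgt e) du := by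
    intro t ht
    obtain ⟨ht1, ht2⟩ := Finset.mem_product.1 (hRim ht)
    rcases Finset.mem_union.1 ht2 with ht2 | ht2
    · exact Finset.mem_union_left _ (Finset.mem_product.2 ⟨ballFin_mono X w₀ (le_of_eq hEQ.symm) ht1, ht2⟩)
    · rcases Finset.mem_union.1 (C.Hfull_subset_Q_union_Efar (tgt e) du ht2) with ht3 | ht3
      · exact Finset.mem_union_left _ (Finset.mem_product.2 ⟨ballFin_mono X w₀ (le_of_eq hEQ.symm) ht1, ht3⟩)
      · exact Finset.mem_union_right _ (Finset.mem_product.2 ⟨ballFin_mono X w₀ hEfar ht1, ht3⟩)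
  have hRimD : Rim ⊆ D := by
    intro t ht
    refine Finset.mem_filter.2 ⟨hRimW ht, fun htV => ?_⟩
    exact Finset.disjoint_left.1 (KSchA.disjoint_Vx_of_fresh hL hQ hV hdu hRimHab) ht htV
  -- entrances are deep
  have hA : ∀ a b, a ∉ D → b ∈ D → G.Adj a b → S.Wcor G FD h e α a' du s(a, b) ≠ 0 → b.1 ∈ ballFin X w₀ (R₀ + 1) := by
    intro a b haD hbD hadj hW
    have haU : a ∈ S.Ucor G FD h e α a' du := by
      by_contra haU
      exact hW (restrW_apply_of_not_mem _ fun hw => haU (Finset.mem_coe.1 (mk_mem_wireSet_iff.1 hw).1))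
    have haV : a ∈ S.Vx G h := hUout a haU haD
    exact fst_mem_ballFin_succ_of_adj' X hadj (hdeep a haV b (hDW hbD) (hDV b hbD) hadj)
  -- planar/fibre boundedness of `D`
  have hDbox : D ⊆ ballFin X w₀ E ×ˢ (box 2 (25 * C.r)).image (fun s => s + C.cen (tgt e)) := fun b hb =>
    Finset.mem_product.2 ⟨hWπ b (hDW hb), hWpl b (hDW hb)⟩
  exact real_rim_le_of_radius X hWD (fun b hb => hWπ b (hDW hb)) hWG hroot hRimD hRimfar hA hR₁ hR hDbox

end BoxProdZ2

end Transplant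

end Summit.CriticalPhenomena.PercolationContinuityZ3.Theorems

end
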